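import Literature.MathematicalPhysics.QuantumFieldTheory.Balaban1983to89.B9Ineq385VG
import Literature.MathematicalPhysics.QuantumFieldTheory.Balaban1983to89.B6RandomWalkKernel

/-!
# `Balaban1983to89.B9Ineq385Kernel` — [Balaban1985BackgroundPropagators] (3.85)–(3.86) p. 407 ⇒ (3.42) p. 397 FOR `G(U′U)` IN THE PRINTED
# KERNEL FORM `|(X·G(U′U)·Y)(x,x′)| ≦ B·P(y)·(L^{j′}η)^{−d}·e^{−ρd(y,y′)}`: the sentence «the local ones follow from the bound (3.85) and
# Lemma 2.1 [4]» made precise — (3.85) in KERNEL-ON-THE-RIGHT form from the gradient-form letters of `V(A)` and Theorem 3.3's kernel bounds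
# (`ineq385_kernel`), and the resolvent step `X·G(U′U)·Y = X·G(U)·Y + (X·G(U′U))·(V(A)G(U)·Y)` (`gExt_kernelEntry_of_386`) — FILE 22 of the
# Sect. B programme of cell `lit-balaban`, seat r06 (B9 fold owner) gen 13; generic carrier, as FILE 7 (`B9Ineq385VG`)

statement-level skeleton of published theorems with citation tags; proofs where landed; nothing here is a claim about the Yang–Mills mass gap

CITATION HEADER (lean-in-tree rule).  B9 = T. Bałaban, *Propagators for lattice gauge theories in a background field*, Commun. Math. Phys. **99**
(1985) 389–434 (journal page = PDF page + 388).  p. 407 [PDF 19], after (3.84): «Using the bounds (3.73), (3.77), (3.83) and assuming that Theorem 3.3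
holds for G(U), we get |(V(A)G(U)J)(b)| ≦ O(1)α₁e^{−(1/2)δ₀d(y,y′)}|J| for b ∈ Δ(y), supp J ⊂ Δ(y′). (3.85) … G(U′U) = G(U)(I − V(A)G(U))⁻¹ =
Σ_{n=0}^{∞} G(U)(V(A)G(U))ⁿ, (3.86) … This way we get all these inequalities for the operator G(U′U), the local ones follow from the bound (3.85)
and Lemma 2.1 [4].»  (3.42) p. 397 [PDF 9]: «|G′(x,x′)|, |(∇_U G′)(b,x′)|, |(G′∇*_U)(x,b′)|, |(∇_U G′∇*_U)(b,b′)| ≦ B₀[(Lʲη)², Lʲη, Lʲη, 1]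
(L^{j′}η)^{−d}e^{−δ₀d(y,y′)} for x ∈ Δ(y), x′ ∈ Δ(y′), y ∈ Λ_j, y′ ∈ Λ_{j′}» — the PRINTED KERNEL SHAPE, typed `B6RandomWalkKernel.HasKernelBound`
(kernels for the pairing Σ_x η^d f(x)g(x) of p. 391, volume weight `v(y′) = (L^{j′}η)^d`).  [4] = [Balaban1984PropagatorsII] (2.51)–(2.55) p. 232,
Lemma 2.1 (2.60)–(2.61) p. 234, (2.68) p. 235.  Rows B9.Thm3.4 × B9.Eq3.85 × B9.Thm3.3 (cells only).

WHY THIS FILE.  FILES 7–20 deliver Theorem 3.4's conclusions as pv08 BLOCK MAJORANTS (`|(Tλ)(x)| ≦ K(y,y′)|λ|`, `supp λ ⊂ Δ(y′)`); the paper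
prints KERNEL bounds with the volume factor `(L^{j′}η)^{−d}`, which a sup-normalised majorant cannot see (`B6RandomWalkKernel.hasKernelBound_of_hasMajorant`
only gives `η^{−d}`).  The printed (3.85) is itself a majorant statement; what the kernel bounds of `G(U′U)` need is (3.85) with the KERNEL bound
riding on the right letter `G(U)` — available WITHOUT commutators because `V(A) = V⁰ + V¹·∇ + P₁ + P₂` has multiplication-type letters with small
majorants (`c_Vα₁(Lʲη)^{−2}`, `c_Vα₁(Lʲη)^{−1}`, `κ₁α₁(Lʲη)^{−2}`, `κ₂α₁(Lʲη)^{−2}`: (3.73), (3.77), (3.83)) and Theorem 3.3 prints kernel bounds for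
`G`, `∇G` (and `G∇*`, `∇G∇*`).  Then `X·G(U′U)·Y = X·G·Y + (X·G(U′U))·(V·G·Y)` (from (3.86)) is «majorant × kernel bound» — FILE 21's
`hasKernelBound_mul` — plus the y″-sum of FILE 11's `conv_le`.

WHAT IS PROVED (0 `def`, 0 sorry; generic carrier `W` with block map `blk : W → 𝔅`, geometry `toB6 g R H`, as in FILE 7).
* §1 `hasKernelBound_rate_mono`, **`hasKernelBound_comp_decay`** — the kernel twin of FILE 11's `hasMajorant_comp_decay`: `T₁ ≺ A₁w₁(y)e^{−rd}` (majorant,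
  `r ≧ ρ + (α+β)δ₀`) and `|T₂(x,x′)| ≦ A₂w₂(y)e^{−ρd}v(y′)⁻¹` give `|(T₁T₂)(x,x′)| ≦ A₁A₂Λc₁(β)·w₁(y)w₂(y)·e^{−ρd}·v(y′)⁻¹` (scale transfer `Λ` for `w₂`).
* §2 **`ineq385_kernel`** — (3.85) IN KERNEL FORM with a general right factor `T` (print: `T = G(U)`, weight `w = (Lʲη)²`; also `T = G(U)∇*_U`, `w = Lʲη`):
  from `V₃ = V⁰ + V¹·D`, the letter majorants of (3.73)/(3.77)/(3.83) at rate `δ`, and the KERNEL bounds `|T(x,x′)| ≦ B₀w(y)e^{−δd}v⁻¹`,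
  `|(DT)(x,x′)| ≦ B₀w(y)(Lʲη)^{−1}e^{−δd}v⁻¹`: `|(V(A)T)(x,x′)| ≦ κ₃₈₅·α₁·(Lʲη)^{−2}w(y)·e^{−ρd(y,y′)}·v(y′)⁻¹` (`κ₃₈₅ = B9Ineq385VG.kappa385`, the SAME
  constant as the majorant form; `ρ + (α+β)δ₀ ≦ δ`).
* §3 **`gExt_kernelEntry_of_386`** — every entry `(X, Y)` of (3.42) for `G(U′U)` in kernel form: from (3.86) as `G(U′U) = G(U) + G(U′U)·(V(A)G(U))`,
  Theorem 3.3's kernel bound for `X·G(U)·Y` (`B₀P(y)e^{−rd}v⁻¹`), the block majorant of `X·G(U′U)` (`B P(y)e^{−r′d}`, the OUTPUT of the universal left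
  clause of `B9Thm34GFinal.thm34_G_clause_final` / FILE 7's `gExt_leftEntry_of_386`) and §2 for `T = G(U)·Y` (`θ·Q(y)e^{−ρd}v⁻¹`):
  `|(X·G(U′U)·Y)(x,x′)| ≦ (B₀ + B·θ·Λc₁(β))·P(y)·max-weight·e^{−ρd}·v(y′)⁻¹` — stated with `P·Q` bookkeeping explicit.

HONEST SCOPE / NOT CLAIMED.  Generic step only (like FILE 7): the instantiation at the CONCRETE letters of FILE 20 (its `G(U′U)`, the concrete `V₃(A)` with
`B9Eq382V3Letters.hasMajorant_V₃_zero/one`, `P₁(A)` of FILE 12, `P₂(A)` of (3.82)–(3.83)) at FILE 20's rate cascade is ~300 lines of plumbing left to a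
successor; the block-volume hypothesis `η^d·#Δ(y′) ≦ c_v(L^{j′}η)^d` enters only when kernel bounds are turned back into majorants (FILE 21), not here;
Hölder / L² entries (3.43)–(3.46) not treated.
-/

noncomputable section

namespace Literature.MathematicalPhysics.QuantumFieldTheory.Balaban1983to89.B9Ineq385Kernel

open Literature.MathematicalPhysics.QuantumFieldTheory.Balaban1983to89
open Literature.MathematicalPhysics.QuantumFieldTheory.Balaban1983to89.B6RandomWalk (HasMajorant hasMajorant_mono Triangle254 Ineq261)
open Literature.MathematicalPhysics.QuantumFieldTheory.Balaban1983to89.B6RandomWalkKernel (ker HasKernelBound hasKernelBound_mul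
  hasKernelBound_add hasKernelBound_mono)
open Literature.MathematicalPhysics.QuantumFieldTheory.Balaban1983to89.B9Thm34Ext (toB6)
open Literature.MathematicalPhysics.QuantumFieldTheory.Balaban1983to89.B9Ineq347 (ScaleTransfer)
open Literature.MathematicalPhysics.QuantumFieldTheory.Balaban1983to89.B9Ineq366CPrime (conv_le)
open Literature.MathematicalPhysics.QuantumFieldTheory.Balaban1983to89.B9Eq386Neumann (vTotal)
open Literature.MathematicalPhysics.QuantumFieldTheory.Balaban1983to89.B9Ineq385VG (kappa385)

/-! ## §1  Composition: block majorant × decaying kernel bound -/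

/-- `e^{−r t} ≦ e^{−ρ t}` for `ρ ≦ r`, `t ≧ 0`. [folklore] [cite: Balaban1984PropagatorsII, (2.54) p.232] -/
theorem exp_rate_mono {ρ r t : ℝ} (h : ρ ≤ r) (ht : 0 ≤ t) : Real.exp (-(r * t)) ≤ Real.exp (-(ρ * t)) :=
  Real.exp_le_exp.mpr (by nlinarith)

section Conv

variable {g : B9.Geometry} [Fintype g.Site] {R : ℝ} {H : Prop} {W : Type} [Fintype W] [DecidableEq W]

omit [Fintype W] in
/-- Weakening the rate of a decaying kernel bound. [cite: Balaban1985BackgroundPropagators, (3.42) p.397; Balaban1984PropagatorsII, (2.54) p.232] -/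
theorem hasKernelBound_rate_mono (blk : W → g.Site) {v : g.Site → ℝ} (hv : ∀ y, 0 < v y) (c : ℝ) {T : Module.End ℝ (W → ℝ)}
    (A : ℝ) (w : g.Site → ℝ) {ρ r : ℝ} (hA : 0 ≤ A) (hw : ∀ a, 0 ≤ w a) (hρr : ρ ≤ r) (hdnn : ∀ a b : g.Site, 0 ≤ g.dist a b)
    (h : HasKernelBound (g := toB6 g R H) blk v c T (fun a b => A * w a * Real.exp (-(r * g.dist a b)))) :
    HasKernelBound (g := toB6 g R H) blk v c T (fun a b => A * w a * Real.exp (-(ρ * g.dist a b))) :=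
  hasKernelBound_mono (g := toB6 g R H) blk hv h fun a b =>
    mul_le_mul_of_nonneg_left (exp_rate_mono hρr (hdnn a b)) (mul_nonneg hA (hw a))

/-- **BLOCK MAJORANT × DECAYING KERNEL BOUND** (the kernel twin of `B9Ineq366CPrime.hasMajorant_comp_decay`): `T₁ ≺ A₁w₁(y)e^{−rd(y,y″)}`
(`r ≧ ρ + (α+β)δ₀`) and `|T₂(x″,x′)| ≦ A₂w₂(y″)e^{−ρd(y″,y′)}v(y′)⁻¹`, with the scale transfer `Λ` for `w₂` at exponent `α` and (2.61) at `β`, give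
`|(T₁T₂)(x,x′)| ≦ A₁A₂Λc₁(β)·w₁(y)w₂(y)·e^{−ρd(y,y′)}·v(y′)⁻¹` — FILE 21's `hasKernelBound_mul` and the y″-sum `conv_le` («in the same way as in the
bounds (2.68) in [4]»). [cite: Balaban1985BackgroundPropagators, p.407 «the local ones follow from the bound (3.85) and Lemma 2.1 [4]» + (3.66) p.403;
Balaban1984PropagatorsII, (2.52)–(2.55) p.232 + (2.68) p.235] -/
theorem hasKernelBound_comp_decay (blk : W → g.Site) (d : ℕ) (δ₀ α β ρ r C A₁ A₂ : ℝ) (w₁ w₂ : g.Site → ℝ)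
    (hw₁ : ∀ a, 0 ≤ w₁ a) (hw₂ : ∀ a, 0 ≤ w₂ a) (hC : 0 ≤ C) (hA₁ : 0 ≤ A₁) (hA₂ : 0 ≤ A₂) (hρ : 0 ≤ ρ)
    (hr : ρ + (α + β) * δ₀ ≤ r) (hdnn : ∀ a b : g.Site, 0 ≤ g.dist a b)
    (htri : Triangle254 (toB6 g R H)) (hST : ScaleTransfer g δ₀ α C w₂) (h261 : Ineq261 d (toB6 g R H) δ₀ β)
    {v : g.Site → ℝ} (hv : ∀ y, 0 < v y) {c : ℝ} (hc : 0 < c) {T₁ T₂ : Module.End ℝ (W → ℝ)}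
    (h₁ : HasMajorant (g := toB6 g R H) blk T₁ (fun a b => A₁ * w₁ a * Real.exp (-(r * g.dist a b))))
    (h₂ : HasKernelBound (g := toB6 g R H) blk v c T₂ (fun a b => A₂ * w₂ a * Real.exp (-(ρ * g.dist a b)))) :
    HasKernelBound (g := toB6 g R H) blk v c (T₁ * T₂)
      (fun a b => (A₁ * A₂ * C * B6.c1 d δ₀ β) * (w₁ a * w₂ a) * Real.exp (-(ρ * g.dist a b))) := by
  have hK₂ : ∀ a b : g.Site, 0 ≤ A₂ * w₂ a * Real.exp (-(ρ * g.dist a b)) := fun a b =>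
    mul_nonneg (mul_nonneg hA₂ (hw₂ a)) (Real.exp_nonneg _)
  refine hasKernelBound_mono (g := toB6 g R H) blk hv (hasKernelBound_mul (g := toB6 g R H) blk hv hc hK₂ h₁ h₂) fun a b => ?_
  have hcv := conv_le (R := R) (H := H) d δ₀ α β ρ r C w₁ w₂ hw₁ hw₂ hC hρ hr hdnn htri hST h261 a b
  calc ∑ y'' : g.Site, A₁ * w₁ a * Real.exp (-(r * g.dist a y'')) * (A₂ * w₂ y'' * Real.exp (-(ρ * g.dist y'' b)))
      = (A₁ * A₂) * ∑ y'' : g.Site, (w₁ a * Real.exp (-(r * g.dist a y''))) * (w₂ y'' * Real.exp (-(ρ * g.dist y'' b))) := by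
        rw [Finset.mul_sum]
        exact Finset.sum_congr rfl fun y'' _ => by ring
    _ ≤ (A₁ * A₂) * (C * B6.c1 d δ₀ β * (w₁ a * w₂ a) * Real.exp (-(ρ * g.dist a b))) :=
        mul_le_mul_of_nonneg_left hcv (mul_nonneg hA₁ hA₂)
    _ = (A₁ * A₂ * C * B6.c1 d δ₀ β) * (w₁ a * w₂ a) * Real.exp (-(ρ * g.dist a b)) := by ring

end Conv

/-! ## §2  (3.85) in kernel form: `|(V(A)T)(x,x′)| ≦ κ₃₈₅α₁(Lʲη)^{−2}w(y)·e^{−ρd}·(L^{j′}η)^{−d}` -/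

section Ineq385K

variable {g : B9.Geometry} [Fintype g.Site] {R : ℝ} {H : Prop} {W : Type} [Fintype W] [DecidableEq W]

/-- **(3.85) WITH THE KERNEL BOUND ON THE RIGHT LETTER.**  «Using the bounds (3.73), (3.77), (3.83) and assuming that Theorem 3.3 holds for G(U), we
get (3.85)»: for `V(A) = V₃ + P₁ + P₂` with `V₃ = V⁰ + V¹·D` (gradient form), the letter majorants `V⁰ ≺ c_Vα₁(Lʲη)^{−2}e^{−δd}`, `V¹ ≺ c_Vα₁(Lʲη)^{−1}e^{−δd}`
((3.73)), `P₁ ≺ κ₁α₁(Lʲη)^{−2}e^{−δd}` ((3.77)), `P₂ ≺ κ₂α₁(Lʲη)^{−2}e^{−δd}` ((3.83)), and a right factor `T` with the KERNEL bounds `|T(x,x′)| ≦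
B₀w(y)e^{−δd}v(y′)⁻¹`, `|(DT)(x,x′)| ≦ B₀w(y)(Lʲη)^{−1}e^{−δd}v(y′)⁻¹` (Theorem 3.3 (3.42)₁,₂ for `T = G(U)`, `w = (Lʲη)²`; (3.42)₃,₄ for `T = G(U)∇*_U`,
`w = Lʲη`), the scale transfers `Λ` for `w` and `w·(Lʲη)^{−1}` and (2.61) at `β`, rate budget `ρ + (α+β)δ₀ ≦ δ`:
`|(V(A)T)(x,x′)| ≦ κ₃₈₅·α₁·(Lʲη)^{−2}w(y)·e^{−ρd(y,y′)}·v(y′)⁻¹` with `κ₃₈₅ = B₀Λc₁(β)(2c_V + κ₁ + κ₂)` — the constant of the majorant form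
`B9Ineq385VG.ineq385_op`. [cite: Balaban1985BackgroundPropagators, (3.85) p.407 + (3.73) p.405 + (3.77) p.406 + (3.83) p.407 + (3.42) p.397;
Balaban1984PropagatorsII, (2.52)–(2.55) p.232 + Lemma 2.1 p.234] -/
theorem ineq385_kernel (blk : W → g.Site) (d : ℕ) (δ₀ δ α β ρ Λ B₀ cV κ₁ κ₂ α₁ : ℝ) (w : g.Site → ℝ)
    (hB₀ : 0 ≤ B₀) (hcV : 0 ≤ cV) (hκ₁ : 0 ≤ κ₁) (hκ₂ : 0 ≤ κ₂) (hα₁ : 0 ≤ α₁) (hΛ : 0 ≤ Λ) (hρ : 0 ≤ ρ)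
    (hα : 0 ≤ α) (hβ : 0 ≤ β) (hδ₀ : 0 ≤ δ₀) (hr : ρ + (α + β) * δ₀ ≤ δ) (hw : ∀ a, 0 ≤ w a)
    (hdnn : ∀ a b : g.Site, 0 ≤ g.dist a b) (htri : Triangle254 (toB6 g R H)) (hlen : ∀ y : g.Site, 0 < g.len y)
    (h261 : Ineq261 d (toB6 g R H) δ₀ β)
    (hT1 : ScaleTransfer g δ₀ α Λ w) (hT2 : ScaleTransfer g δ₀ α Λ (fun a => w a * (g.len a)⁻¹))
    {v : g.Site → ℝ} (hv : ∀ y, 0 < v y) {c : ℝ} (hc : 0 < c)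
    {T D V₃ V0 V1 P₁ P₂ : Module.End ℝ (W → ℝ)} (hV₃ : V₃ = V0 + V1 * D)
    (hV0 : HasMajorant (g := toB6 g R H) blk V0 (fun a b => cV * α₁ * (g.len a ^ 2)⁻¹ * Real.exp (-(δ * g.dist a b))))
    (hV1 : HasMajorant (g := toB6 g R H) blk V1 (fun a b => cV * α₁ * (g.len a)⁻¹ * Real.exp (-(δ * g.dist a b))))
    (hP₁ : HasMajorant (g := toB6 g R H) blk P₁ (fun a b => κ₁ * α₁ * (g.len a ^ 2)⁻¹ * Real.exp (-(δ * g.dist a b))))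
    (hP₂ : HasMajorant (g := toB6 g R H) blk P₂ (fun a b => κ₂ * α₁ * (g.len a ^ 2)⁻¹ * Real.exp (-(δ * g.dist a b))))
    (hT : HasKernelBound (g := toB6 g R H) blk v c T (fun a b => B₀ * w a * Real.exp (-(δ * g.dist a b))))
    (hDT : HasKernelBound (g := toB6 g R H) blk v c (D * T) (fun a b => B₀ * (w a * (g.len a)⁻¹) * Real.exp (-(δ * g.dist a b)))) :
    HasKernelBound (g := toB6 g R H) blk v c (vTotal V₃ P₁ P₂ * T)
      (fun a b => kappa385 B₀ cV κ₁ κ₂ Λ (B6.c1 d δ₀ β) * α₁ * ((g.len a ^ 2)⁻¹ * w a) * Real.exp (-(ρ * g.dist a b))) := by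
  have hw1i : ∀ a : g.Site, 0 ≤ (g.len a)⁻¹ := fun a => inv_nonneg.mpr (hlen a).le
  have hw2i : ∀ a : g.Site, 0 ≤ (g.len a ^ 2)⁻¹ := fun a => inv_nonneg.mpr (sq_nonneg _)
  have hwl : ∀ a : g.Site, 0 ≤ w a * (g.len a)⁻¹ := fun a => mul_nonneg (hw a) (hw1i a)
  have hcVα : 0 ≤ cV * α₁ := mul_nonneg hcV hα₁
  have hκ₁α : 0 ≤ κ₁ * α₁ := mul_nonneg hκ₁ hα₁
  have hκ₂α : 0 ≤ κ₂ * α₁ := mul_nonneg hκ₂ hα₁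
  have hρδ : ρ ≤ δ := by
    have : 0 ≤ (α + β) * δ₀ := by positivity
    linarith
  -- rate-weakened right letters
  have hTρ := hasKernelBound_rate_mono (R := R) (H := H) blk hv c B₀ w hB₀ hw hρδ hdnn hT
  have hDTρ := hasKernelBound_rate_mono (R := R) (H := H) blk hv c B₀ (fun a => w a * (g.len a)⁻¹) hB₀ hwl hρδ hdnn hDT
  -- the four words
  have w1 := hasKernelBound_comp_decay (R := R) (H := H) blk d δ₀ α β ρ δ Λ (cV * α₁) B₀ (fun a => (g.len a ^ 2)⁻¹) w
    hw2i hw hΛ hcVα hB₀ hρ hr hdnn htri hT1 h261 hv hc hV0 hTρ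
  have w2 := hasKernelBound_comp_decay (R := R) (H := H) blk d δ₀ α β ρ δ Λ (cV * α₁) B₀ (fun a => (g.len a)⁻¹)
    (fun a => w a * (g.len a)⁻¹) hw1i hwl hΛ hcVα hB₀ hρ hr hdnn htri hT2 h261 hv hc hV1 hDTρ
  have w3 := hasKernelBound_comp_decay (R := R) (H := H) blk d δ₀ α β ρ δ Λ (κ₁ * α₁) B₀ (fun a => (g.len a ^ 2)⁻¹) w
    hw2i hw hΛ hκ₁α hB₀ hρ hr hdnn htri hT1 h261 hv hc hP₁ hTρ
  have w4 := hasKernelBound_comp_decay (R := R) (H := H) blk d δ₀ α β ρ δ Λ (κ₂ * α₁) B₀ (fun a => (g.len a ^ 2)⁻¹) w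
    hw2i hw hΛ hκ₂α hB₀ hρ hr hdnn htri hT1 h261 hv hc hP₂ hTρ
  have hsum := hasKernelBound_add (g := toB6 g R H) blk
    (hasKernelBound_add (g := toB6 g R H) blk (hasKernelBound_add (g := toB6 g R H) blk w1 w2) w3) w4
  have e : vTotal V₃ P₁ P₂ * T = V0 * T + V1 * (D * T) + P₁ * T + P₂ * T := by
    rw [vTotal, hV₃]
    noncomm_ring
  rw [e]
  refine hasKernelBound_mono (g := toB6 g R H) blk hv hsum fun a b => le_of_eq ?_
  have ha : g.len a ≠ 0 := (hlen a).ne'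
  simp only [kappa385]
  field_simp
  ring

end Ineq385K

/-! ## §3  (3.86) ⇒ the entries of (3.42) for `G(U′U)` in kernel form -/

section Entries

variable {g : B9.Geometry} [Fintype g.Site] {R : ℝ} {H : Prop} {W : Type} [Fintype W] [DecidableEq W]

/-- **(3.86) ⇒ (3.42)_{X,Y} FOR `G(U′U)` IN THE PRINTED KERNEL FORM.**  From the resolvent form `G(U′U) = G(U) + G(U′U)·(V(A)G(U))` of (3.86),
`X·G(U′U)·Y = X·G(U)·Y + (X·G(U′U))·(V(A)G(U)·Y)`; hence Theorem 3.3's kernel bound `|(X·G(U)·Y)(x,x′)| ≦ B₀P(y)Q(y)e^{−rd}v(y′)⁻¹`, the block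
majorant `X·G(U′U) ≺ B·P(y)e^{−r′d}` (the universal left clause of Theorem 3.4, `B9Thm34GFinal.thm34_G_clause_final` / FILE 7's
`gExt_leftEntry_of_386`) and (3.85) in kernel form for the right factor `G(U)·Y` (`|(V(A)G(U)Y)(x,x′)| ≦ θ·Q(y)e^{−ρd}v⁻¹`, §2) give, with the scale
transfer `Λ` for `Q` and (2.61) at `β` (`r′ ≧ ρ + (α+β)δ₀`, `r ≧ ρ`):
`|(X·G(U′U)·Y)(x,x′)| ≦ (B₀ + B·θ·Λc₁(β))·P(y)Q(y)·e^{−ρd(y,y′)}·v(y′)⁻¹`.  Entries: `(X,Y) = (1,1)`: `P·Q = (Lʲη)²`; `(∇,1)`: `Lʲη`; `(1,∇*)`: `Lʲη`;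
`(∇,∇*)`: `1` (p. 397). [cite: Balaban1985BackgroundPropagators, (3.86) p.407 + «the local ones follow from the bound (3.85) and Lemma 2.1 [4]» p.407 +
(3.42) p.397 + Thm 3.4 p.400; Balaban1984PropagatorsII, (2.52)–(2.55) p.232 + Lemma 2.1 p.234] -/
theorem gExt_kernelEntry_of_386 (blk : W → g.Site) (d : ℕ) (δ₀ α β ρ r r' Λ B₀ B θ : ℝ) (P Q : g.Site → ℝ)
    (hB₀ : 0 ≤ B₀) (hB : 0 ≤ B) (hθ : 0 ≤ θ) (hP : ∀ y, 0 ≤ P y) (hQ : ∀ y, 0 ≤ Q y) (hΛ : 0 ≤ Λ) (hρ : 0 ≤ ρ)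
    (hr' : ρ + (α + β) * δ₀ ≤ r') (hrρ : ρ ≤ r) (hdnn : ∀ a b : g.Site, 0 ≤ g.dist a b) (htri : Triangle254 (toB6 g R H))
    (hST : ScaleTransfer g δ₀ α Λ Q) (h261 : Ineq261 d (toB6 g R H) δ₀ β)
    {v : g.Site → ℝ} (hv : ∀ y, 0 < v y) {c : ℝ} (hc : 0 < c)
    {X Y GU GExt VG : Module.End ℝ (W → ℝ)} (h386 : GExt = GU + GExt * VG)
    (h342 : HasKernelBound (g := toB6 g R H) blk v c (X * GU * Y) (fun a b => B₀ * (P a * Q a) * Real.exp (-(r * g.dist a b))))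
    (hXGExt : HasMajorant (g := toB6 g R H) blk (X * GExt) (fun a b => B * P a * Real.exp (-(r' * g.dist a b))))
    (h385 : HasKernelBound (g := toB6 g R H) blk v c (VG * Y) (fun a b => θ * Q a * Real.exp (-(ρ * g.dist a b)))) :
    HasKernelBound (g := toB6 g R H) blk v c (X * GExt * Y)
      (fun a b => (B₀ + B * θ * Λ * B6.c1 d δ₀ β) * (P a * Q a) * Real.exp (-(ρ * g.dist a b))) := by
  have hPQ : ∀ a, 0 ≤ P a * Q a := fun a => mul_nonneg (hP a) (hQ a)
  -- the resolvent step
  have e : X * GExt * Y = X * GU * Y + (X * GExt) * (VG * Y) := by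
    conv_lhs => rw [h386]
    noncomm_ring
  have h1 := hasKernelBound_rate_mono (R := R) (H := H) blk hv c B₀ (fun a => P a * Q a) hB₀ hPQ hrρ hdnn h342
  have h2 := hasKernelBound_comp_decay (R := R) (H := H) blk d δ₀ α β ρ r' Λ B θ P Q hP hQ hΛ hB hθ hρ hr' hdnn htri hST h261
    hv hc hXGExt h385
  rw [e]
  refine hasKernelBound_mono (g := toB6 g R H) blk hv (hasKernelBound_add (g := toB6 g R H) blk h1 h2) fun a b => le_of_eq ?_
  ring

/-- **The (1,1) entry spelled out**: `|G(U′U)(x,x′)| ≦ (B₀ + BθΛc₁(β))·(Lʲη)²·e^{−ρd(y,y′)}·(L^{j′}η)^{−d}` from `|G(U)(x,x′)| ≦ B₀(Lʲη)²e^{−rd}(L^{j′}η)^{−d}`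
((3.42)₁ for `G(U)`), `G(U′U) ≺ B(Lʲη)²e^{−r′d}` (Theorem 3.4's clause in majorant form) and `|(V(A)G(U))(x,x′)| ≦ θe^{−ρd}(L^{j′}η)^{−d}` ((3.85) in
kernel form, §2 with `w = (Lʲη)²`). [cite: Balaban1985BackgroundPropagators, (3.42) p.397 + (3.85)–(3.86) p.407 + Thm 3.4 p.400] -/
theorem gExt_kernelEntry1_of_386 (blk : W → g.Site) (d : ℕ) (δ₀ α β ρ r r' B₀ B θ : ℝ)
    (hB₀ : 0 ≤ B₀) (hB : 0 ≤ B) (hθ : 0 ≤ θ) (hρ : 0 ≤ ρ) (hαδ : 0 ≤ α * δ₀)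
    (hr' : ρ + (α + β) * δ₀ ≤ r') (hrρ : ρ ≤ r) (hdnn : ∀ a b : g.Site, 0 ≤ g.dist a b) (htri : Triangle254 (toB6 g R H))
    (h261 : Ineq261 d (toB6 g R H) δ₀ β)
    {v : g.Site → ℝ} (hv : ∀ y, 0 < v y) {c : ℝ} (hc : 0 < c)
    {GU GExt VG : Module.End ℝ (W → ℝ)} (h386 : GExt = GU + GExt * VG)
    (h342 : HasKernelBound (g := toB6 g R H) blk v c GU (fun a b => B₀ * g.len a ^ 2 * Real.exp (-(r * g.dist a b))))
    (hGExt : HasMajorant (g := toB6 g R H) blk GExt (fun a b => B * g.len a ^ 2 * Real.exp (-(r' * g.dist a b))))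
    (h385 : HasKernelBound (g := toB6 g R H) blk v c VG (fun a b => θ * Real.exp (-(ρ * g.dist a b)))) :
    HasKernelBound (g := toB6 g R H) blk v c GExt
      (fun a b => (B₀ + B * θ * 1 * B6.c1 d δ₀ β) * g.len a ^ 2 * Real.exp (-(ρ * g.dist a b))) := by
  have hST1 : ScaleTransfer g δ₀ α 1 (fun _ : g.Site => (1 : ℝ)) := fun y y' => by
    rw [mul_one, one_mul]
    exact Real.exp_le_one_iff.mpr (by nlinarith [hdnn y y'])
  have h342' : HasKernelBound (g := toB6 g R H) blk v c (1 * GU * 1)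
      (fun a b => B₀ * (g.len a ^ 2 * 1) * Real.exp (-(r * g.dist a b))) := by
    rw [one_mul, mul_one]; simpa only [mul_one] using h342
  have hGExt' : HasMajorant (g := toB6 g R H) blk (1 * GExt) (fun a b => B * g.len a ^ 2 * Real.exp (-(r' * g.dist a b))) := by
    rw [one_mul]; exact hGExt
  have h385' : HasKernelBound (g := toB6 g R H) blk v c (VG * 1) (fun a b => θ * 1 * Real.exp (-(ρ * g.dist a b))) := by
    rw [mul_one]; simpa only [mul_one] using h385
  have h := gExt_kernelEntry_of_386 (R := R) (H := H) blk d δ₀ α β ρ r r' 1 B₀ B θ (fun a => g.len a ^ 2) (fun _ => 1)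
    hB₀ hB hθ (fun a => sq_nonneg _) (fun _ => zero_le_one) zero_le_one hρ hr' hrρ hdnn htri hST1 h261 hv hc h386 h342' hGExt' h385'
  rw [one_mul, mul_one] at h
  exact hasKernelBound_mono (g := toB6 g R H) blk hv h fun a b => le_of_eq (by ring)

end Entries

end Literature.MathematicalPhysics.QuantumFieldTheory.Balaban1983to89.B9Ineq385Kernel

end
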